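import Summits.Schanuel.Schanuel.Theorems.ZilberEacFibreCurveAlgebraicCurve
import Summits.Schanuel.Schanuel.Theorems.ZilberEacEllipticBaseExample
import HarnessLib

/-!
# Arbitrary base branches, XCIV: EXAMPLES of fibre curves over curves defined over `ℚ̄` —
# `{x₁² − x₀²x₁ = 1, y₀² = x₀}` and `{x₁² − x₀²x₁ = 1, y₀² = x₀x₁ + 1}`

HONEST FRAMING.  Cell `pub-schanuel` (Zilber's Exponential-Algebraic Closedness, case ladder;
host summit Schanuel), seat 2, gen 33.  Instances of the headline of file XCIII
(`unprojectedDense_fibreCurve_algebraicCurve`) over the genus-one curve `C : x₁² − x₀²x₁ = 1`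
(gen 28, `irreducible_genusOne_baseRow`; integer coefficients, not a line) with genuine fibre
CURVES (`y₀`-degree `2`, not polynomial or rational fibres): every irreducible surface of dimension
`≤ 2` containing the points `(x₀, x₁, y₀, e^{x₁})` with `x ∈ C` and `y₀² = x₀` (resp.
`y₀² = x₀x₁ + 1`) has Zariski-dense exponential points.  The hypotheses of the headline are
checked by degree: the top coefficient `1`, the bottom coefficient and the `y`-discriminant
(`4x₀`, resp. `4(x₀x₁ + 1)`, via Mathlib's `resultant_deriv` / `discr_of_degree_eq_two`) have
`x₁`-degree `< 2 = deg_{x₁} F`, so `F` divides none of them.  Decided instances of an OPEN question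
(Mantova–Masser, PLMS 2024 §1 p. 5); EC(3,2) OPEN; NOT Schanuel's conjecture (neither used nor
implied); EAC ⇏ SC.
-/

noncomputable section

open Filter Topology Set Complex Polynomial
open Literature.NumberTheory.Transcendental Literature.ModelTheory.Zilber
open Literature.ModelTheory.ExponentialFields

set_option linter.dupNamespace false

namespace Summit.Schanuel.Schanuel.Theorems

section FibreCurveExamples

/-! ## Part A. Small tools -/

/-- A nonzero `G` of smaller `x₁`-degree is not divisible by `F`. [folklore] -/
theorem not_dvd_of_natDegree_lt' {F G : ℂ[X][X]} (hG : G ≠ 0) (hlt : G.natDegree < F.natDegree) :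
    ¬ F ∣ G := fun h => (Nat.lt_irrefl _) (lt_of_le_of_lt (Polynomial.natDegree_le_of_dvd h hG) hlt)

/-- The `y`-discriminant hypothesis for a monic quadratic fibre curve `y² - c(x₀, x₁)`:
`Res_y(P, ∂_yP) = -4c`. [folklore] -/
theorem resultant_sq_sub_C (c : ℂ[X][X]) :
    Polynomial.resultant (X ^ 2 - Polynomial.C c : Polynomial ℂ[X][X])
        (derivative (X ^ 2 - Polynomial.C c)) (X ^ 2 - Polynomial.C c : Polynomial ℂ[X][X]).natDegree
        ((X ^ 2 - Polynomial.C c : Polynomial ℂ[X][X]).natDegree - 1) = -(4 * c) := by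
  have hdeg : (X ^ 2 - Polynomial.C c : Polynomial ℂ[X][X]).degree = 2 := by
    rw [Polynomial.degree_X_pow_sub_C (by norm_num)]; rfl
  have hnat : (X ^ 2 - Polynomial.C c : Polynomial ℂ[X][X]).natDegree = 2 :=
    Polynomial.natDegree_X_pow_sub_C
  rw [Polynomial.resultant_deriv (by rw [hdeg]; exact two_pos), Polynomial.discr_of_degree_eq_two hdeg,
    hnat, (Polynomial.monic_X_pow_sub_C c two_ne_zero).leadingCoeff]
  simp only [Polynomial.coeff_sub, Polynomial.coeff_X_pow, Polynomial.coeff_C]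
  norm_num
  ring

/-- The genus-one base curve `x₁² - x₀²x₁ - 1` (file of gen 28) as a polynomial over `ℚ`,
mapped to `ℂ`: its coefficients are algebraic. [folklore] -/
theorem genusOne_baseRow_algebraic :
    ∀ i j, IsAlgebraic ℚ (((Polynomial.C (1 : Polynomial ℂ) * Polynomial.X ^ 2 +
      Polynomial.C (-(Polynomial.X ^ 2) : Polynomial ℂ) * Polynomial.X +
      Polynomial.C (-1 : Polynomial ℂ)).coeff j).coeff i) := by
  intro i j
  set Fq : ℚ[X][X] := Polynomial.C (1 : Polynomial ℚ) * Polynomial.X ^ 2 +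
      Polynomial.C (-(Polynomial.X ^ 2) : Polynomial ℚ) * Polynomial.X +
      Polynomial.C (-1 : Polynomial ℚ) with hFq
  have hmap : (Polynomial.C (1 : Polynomial ℂ) * Polynomial.X ^ 2 +
      Polynomial.C (-(Polynomial.X ^ 2) : Polynomial ℂ) * Polynomial.X +
      Polynomial.C (-1 : Polynomial ℂ)) = Fq.map (Polynomial.mapRingHom (algebraMap ℚ ℂ)) := by
    rw [hFq]
    simp only [Polynomial.map_add, Polynomial.map_mul, Polynomial.map_pow, Polynomial.map_X,
      Polynomial.map_C, Polynomial.coe_mapRingHom, Polynomial.map_one, Polynomial.map_neg]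
  rw [hmap, Polynomial.coeff_map, Polynomial.coe_mapRingHom, Polynomial.coeff_map]
  exact isAlgebraic_algebraMap _

/-- Evaluation of `y² - c(x₀, x₁)` at `(x₀, x₁, y)`. [folklore] -/
theorem eval_sq_sub_C (c : ℂ[X][X]) (x₀ x₁ y : ℂ) :
    ((X ^ 2 - Polynomial.C c : Polynomial ℂ[X][X]).map
        (Polynomial.eval₂RingHom (Polynomial.evalRingHom x₀) x₁)).eval y =
      y ^ 2 - (c.map (Polynomial.evalRingHom x₀)).eval x₁ := by
  simp only [Polynomial.map_sub, Polynomial.map_pow, Polynomial.map_X, Polynomial.map_C,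
    Polynomial.eval_sub, Polynomial.eval_pow, Polynomial.eval_X, Polynomial.eval_C,
    Polynomial.coe_eval₂RingHom, Polynomial.eval_map]

/-- **Monic quadratic fibre curves `y₀² = c(x₀, x₁)` over a curve over `ℚ̄`**, `c` of
`x₁`-degree `< deg_{x₁} F` and `F ∤ c`... in fact `c ≠ 0` of smaller `x₁`-degree suffices: every
irreducible surface of dimension `≤ 2` through the points `(x, y, e^{x₁})`, `x ∈ C`, `y² = c(x)`,
is dense. [cite: MantovaMasser2023, §1 Further remarks, p. 5 (the question, open in general)]
(new) -/
theorem unprojectedDense_sqFibreCurve_algebraicCurve (F : ℂ[X][X]) (hFirr : Irreducible F)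
    (hF2 : 2 ≤ F.natDegree) (halg : ∀ i j, IsAlgebraic ℚ ((F.coeff j).coeff i))
    (c : ℂ[X][X]) (hc0 : c ≠ 0) (hclt : c.natDegree < F.natDegree)
    {S : Set (Fin 2 ⊕ Fin 2 → ℂ)} (hS : IsIrreducibleClosed ℂ S) (hdim : zariskiDim ℂ S ≤ (2 : ℕ))
    (hsub : ∀ x₀ x₁ y : ℂ, (F.map (Polynomial.evalRingHom x₀)).eval x₁ = 0 →
      y ^ 2 = (c.map (Polynomial.evalRingHom x₀)).eval x₁ →
      (Sum.elim ![x₀, x₁] ![y, Complex.exp x₁] : Fin 2 ⊕ Fin 2 → ℂ) ∈ S) :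
    UnprojectedDense S := by
  classical
  set P : Polynomial ℂ[X][X] := X ^ 2 - Polynomial.C c with hP
  have hnat : P.natDegree = 2 := Polynomial.natDegree_X_pow_sub_C
  have hFnu : ¬ IsUnit F := hFirr.not_isUnit
  have htop : ¬ F ∣ P.leadingCoeff := by
    rw [hP, (Polynomial.monic_X_pow_sub_C c two_ne_zero).leadingCoeff]
    exact fun h => hFnu (isUnit_of_dvd_one h)
  have hbot : ¬ F ∣ P.coeff 0 := by
    rw [hP, Polynomial.coeff_sub, Polynomial.coeff_X_pow, Polynomial.coeff_C_zero, if_neg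
      (by norm_num), zero_sub]
    exact fun h => not_dvd_of_natDegree_lt' hc0 hclt ((dvd_neg).1 h)
  have h4 : (4 * c).natDegree < F.natDegree := by
    rw [show (4 : ℂ[X][X]) = Polynomial.C (Polynomial.C (4 : ℂ)) by simp [map_ofNat],
      Polynomial.natDegree_C_mul (by simp)]
    exact hclt
  have hdisc : ¬ F ∣ Polynomial.resultant P (derivative P) P.natDegree (P.natDegree - 1) := by
    rw [hP, resultant_sq_sub_C]
    exact fun h => not_dvd_of_natDegree_lt' (mul_ne_zero (by norm_num) hc0) h4 ((dvd_neg).1 h)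
  refine unprojectedDense_fibreCurve_algebraicCurve F hFirr (by omega) (fun h => by omega) halg P
    (by rw [hnat]; norm_num) htop hbot hdisc 1 (fun h => hFnu (isUnit_of_dvd_one h)) hS hdim ?_
  intro x₀ x₁ y hF _ _ hPy
  refine hsub x₀ x₁ y hF ?_
  rw [hP, eval_sq_sub_C] at hPy
  exact sub_eq_zero.1 hPy

/-! ## Part B. The two examples over `x₁² - x₀²x₁ = 1` -/

/-- **`{x₁² - x₀²x₁ = 1, y₀² = x₀}`: dense** — every irreducible surface of dimension `≤ 2`
through the points `(x₀, x₁, y₀, e^{x₁})` with `x₁² - x₀²x₁ = 1`, `y₀² = x₀`.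
[cite: MantovaMasser2023, §1 Further remarks, p. 5 (the question, open in general)] (new) -/
theorem unprojectedDense_genusOne_sqrtFibreCurve {S : Set (Fin 2 ⊕ Fin 2 → ℂ)}
    (hS : IsIrreducibleClosed ℂ S) (hdim : zariskiDim ℂ S ≤ (2 : ℕ))
    (hsub : ∀ x₀ x₁ y : ℂ, x₁ ^ 2 - x₀ ^ 2 * x₁ - 1 = 0 → y ^ 2 = x₀ →
      (Sum.elim ![x₀, x₁] ![y, Complex.exp x₁] : Fin 2 ⊕ Fin 2 → ℂ) ∈ S) :
    UnprojectedDense S := by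
  have hF2 : (Polynomial.C (1 : Polynomial ℂ) * Polynomial.X ^ 2 +
      Polynomial.C (-(Polynomial.X ^ 2) : Polynomial ℂ) * Polynomial.X +
      Polynomial.C (-1 : Polynomial ℂ)).natDegree = 2 := by
    rw [map_one, one_mul]; compute_degree!
  refine unprojectedDense_sqFibreCurve_algebraicCurve _ irreducible_genusOne_baseRow (by rw [hF2])
    genusOne_baseRow_algebraic (Polynomial.C Polynomial.X) (by simp) (by rw [hF2]; simp) hS hdim ?_
  intro x₀ x₁ y hF hy
  refine hsub x₀ x₁ y ?_ ?_
  · rw [evalPP_monicQuadratic] at hF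
    simp only [Polynomial.eval_neg, Polynomial.eval_pow, Polynomial.eval_X, Polynomial.eval_one] at hF
    linear_combination hF
  · rw [hy]; simp

/-- **`{x₁² - x₀²x₁ = 1, y₀² = x₀x₁ + 1}`: dense** (a fibre curve depending on both base
coordinates). [cite: MantovaMasser2023, §1 Further remarks, p. 5 (the question, open in general)]
(new) -/
theorem unprojectedDense_genusOne_sqrtFibreCurve' {S : Set (Fin 2 ⊕ Fin 2 → ℂ)}
    (hS : IsIrreducibleClosed ℂ S) (hdim : zariskiDim ℂ S ≤ (2 : ℕ))
    (hsub : ∀ x₀ x₁ y : ℂ, x₁ ^ 2 - x₀ ^ 2 * x₁ - 1 = 0 → y ^ 2 = x₀ * x₁ + 1 →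
      (Sum.elim ![x₀, x₁] ![y, Complex.exp x₁] : Fin 2 ⊕ Fin 2 → ℂ) ∈ S) :
    UnprojectedDense S := by
  have hF2 : (Polynomial.C (1 : Polynomial ℂ) * Polynomial.X ^ 2 +
      Polynomial.C (-(Polynomial.X ^ 2) : Polynomial ℂ) * Polynomial.X +
      Polynomial.C (-1 : Polynomial ℂ)).natDegree = 2 := by
    rw [map_one, one_mul]; compute_degree!
  have hc : (Polynomial.C Polynomial.X * Polynomial.X + 1 : ℂ[X][X]).natDegree = 1 := by
    compute_degree!
  refine unprojectedDense_sqFibreCurve_algebraicCurve _ irreducible_genusOne_baseRow (by rw [hF2])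
    genusOne_baseRow_algebraic (Polynomial.C Polynomial.X * Polynomial.X + 1)
    (fun h => by rw [h, Polynomial.natDegree_zero] at hc; exact zero_ne_one hc)
    (by rw [hF2, hc]; exact one_lt_two) hS hdim ?_
  intro x₀ x₁ y hF hy
  refine hsub x₀ x₁ y ?_ ?_
  · rw [evalPP_monicQuadratic] at hF
    simp only [Polynomial.eval_neg, Polynomial.eval_pow, Polynomial.eval_X, Polynomial.eval_one] at hF
    linear_combination hF
  · rw [hy]; simp

end FibreCurveExamples

end Summit.Schanuel.Schanuel.Theorems
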